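import Summits.AnomalousDissipation.AnomalousDissipation.Theorems.SolenoidalFractalHomogenisationLagrangianStepCellChainRegimeTools
import Summits.AnomalousDissipation.AnomalousDissipation.Theorems.SolenoidalFractalHomogenisationLagrangianStepCellChainClassPair
import Summits.AnomalousDissipation.AnomalousDissipation.Theorems.SolenoidalFractalHomogenisationLagrangianStepCellCorrectorContent
import HarnessLib

/-!
# K1L_D `LagrangianRenormalisationStepDesign` (stmt-AnomalousDissipation-27980), W7 engine: the GAP HYPOTHESIS `hgap` of `W7Cell.cell_slot_contraction` /
# `CellChain.ae_uIcc_pair_split` discharged from class-pair confinement (helper; `--supports stmt-AnomalousDissipation-27980`)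

Summits-side helper file of route `SolenoidalFractalHomogenisation` (prover seat `ad-k1l-cellLawV-w1` g4; ask of the W7 assembly owner ad-sawtooth-k1loc-p1 g11,
STATUS 2026-08-28T22:51:21Z).  Everything proved; no definitions, no named facts, no sorry.

`ae_gap_of_classPair`: for the cell problem `IsWeakTensorPassiveVectorOn 0 T ((1/n²)•𝔸) (cellField W M hM ν _ n) F u` with an `L²` datum supported on the class pair
`(ℓ + nℤ³) ∪ (−ℓ + nℤ³)` and EVERY chain `ℓ + j·K_s` through `ℓ`: for a.e. `t`, every mode `k` of `u t` off the ten vectors `±(ℓ + j·K_s)`, `|j| ≤ 2`, with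
`û(t)(k) ≠ 0` obeys `dmin ≤ 8π²·lo'·|k|²` for ANY `dmin ≤ 8π²·lo'·(n − ‖ℓ‖)²` (`lo'` any real with `0 ≤ lo'`) — because such a `k` lies in the class pair
(`ae_modes_vanish_off_classPair`) and differs from `±ℓ` (the `j = 0` vectors), hence `‖k‖ ≥ n − ‖ℓ‖` (`norm_latticeVec_ge_of_classPair_ne`).  Literal shape of the
`hgap` binder of `…CellChainSlotStepInputs.ae_uIcc_pair_split` (with `K0 := ℓ`).  Variant `ae_gap_of_classPair_half` with `dmin ≤ 2π²·lo'·n²` under `2‖ℓ‖ ≤ n`.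
NOT a proof of any registered stub, of the crux, or of anomalous dissipation; rung F-D1.A0 infrastructure.
-/

set_option linter.dupNamespace false

noncomputable section

namespace Summit.AnomalousDissipation.AnomalousDissipation.Theorems.SolenoidalFractalHomogenisation.LagrangianStep.CellChain

open Set MeasureTheory Filter Topology Function UnitAddTorus
open scoped InnerProductSpace
open Literature.Analysis Literature.Analysis.FunctionSpaces Literature.Analysis.FunctionSpaces.Torus
open Literature.Analysis.FluidPDE Literature.Analysis.FluidPDE.Torus Literature.Analysis.FluidPDE.LatticeShear
open Summit.AnomalousDissipation.AnomalousDissipation.Theorems.SolenoidalFractalHomogenisation.RealisedQuasiStaticCellLaw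
open Summit.AnomalousDissipation.AnomalousDissipation.Theorems.SolenoidalFractalHomogenisation.LagrangianStep

/-- **`hgap` from class-pair confinement.**  See the module docstring. [cite: KhaKuchment2021, §1.1–§1.2 (G-periodic operators, γ_k-automorphic functions)] -/
theorem ae_gap_of_classPair {k₀ : ℕ} (W : LatticeWord k₀) (M : ℝ) (hM : 0 < M) {lo hi lam ν : ℝ} (hlo : 0 < lo)
    (hlam : 0 < lam) (hν : 0 < ν) {n : ℕ} (hn : 0 < n) {𝔸 : Torus.Visc4 (Fin 3)}
    (hA : Torus.NearIso 𝔸 (ν * (lo / lam)) (ν * (hi * lam))) (ℓ : Fin 3 → ℤ) {F : VF} (hF : MemLp F 2 volume)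
    (hsupp : ∀ k' : Fin 3 → ℤ, (¬ ∃ z : Fin 3 → ℤ, k' = ℓ + (n : ℤ) • z) → (¬ ∃ z : Fin 3 → ℤ, k' = -ℓ + (n : ℤ) • z) →
      mFourierCoeff (FunctionSpaces.EuclideanSpace.complexify ∘ F) k' = 0)
    {T : ℝ} {u : ℝ → VF}
    (hu : Torus.IsWeakTensorPassiveVectorOn 0 T ((1 / (n:ℝ) ^ 2) • 𝔸) (cellField W M hM ν hν n) F u)
    (Ks : Fin 3 → ℤ) {lo' dmin : ℝ} (hlo' : 0 ≤ lo') (hdmin : dmin ≤ 8 * Real.pi ^ 2 * lo' * ((n : ℝ) - ‖Torus.latticeVec ℓ‖) ^ 2)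
    (hℓn : ‖Torus.latticeVec ℓ‖ ≤ n) :
    ∀ᵐ t ∂(volume.restrict (Ioo 0 T)), ∀ k : Fin 3 → ℤ,
      (∀ j ∈ ({-2, -1, 0, 1, 2} : Finset ℤ), k ≠ ℓ + j • Ks ∧ k ≠ -(ℓ + j • Ks)) →
      mFourierCoeff (EuclideanSpace.complexify ∘ u t) k ≠ 0 → dmin ≤ 8 * Real.pi ^ 2 * lo' * freqNormSq k := by
  filter_upwards [ae_modes_vanish_off_classPair W M hM hlo hlam hν hn hA ℓ hF hsupp hu] with t ht k hoff hk
  -- `k` lies in the class pair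
  have hmem : (∃ z : Fin 3 → ℤ, k = ℓ + (n : ℤ) • z) ∨ (∃ z : Fin 3 → ℤ, k = -ℓ + (n : ℤ) • z) := by
    by_contra hcon
    rw [not_or] at hcon
    exact hk (ht k hcon.1 hcon.2)
  -- and is not `±ℓ` (the `j = 0` vectors of the window)
  have h0 := hoff 0 (by norm_num)
  rw [zero_zsmul, add_zero] at h0
  have hge := norm_latticeVec_ge_of_classPair_ne hmem h0.1 h0.2
  have hnn : 0 ≤ (n : ℝ) - ‖Torus.latticeVec ℓ‖ := sub_nonneg.2 hℓn
  have hsq : ((n : ℝ) - ‖Torus.latticeVec ℓ‖) ^ 2 ≤ freqNormSq k := by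
    rw [← norm_latticeVec_sq']
    exact pow_le_pow_left₀ hnn hge 2
  exact hdmin.trans (mul_le_mul_of_nonneg_left hsq (by positivity))

/-- The same with the window-number `dmin ≤ 2π²·lo'·n²` under `2‖ℓ‖ ≤ n` (then `(n − ‖ℓ‖)² ≥ n²/4`). [cite: KhaKuchment2021, §1.1–§1.2 (G-periodic operators, γ_k-automorphic functions)] -/
theorem ae_gap_of_classPair_half {k₀ : ℕ} (W : LatticeWord k₀) (M : ℝ) (hM : 0 < M) {lo hi lam ν : ℝ} (hlo : 0 < lo)
    (hlam : 0 < lam) (hν : 0 < ν) {n : ℕ} (hn : 0 < n) {𝔸 : Torus.Visc4 (Fin 3)}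
    (hA : Torus.NearIso 𝔸 (ν * (lo / lam)) (ν * (hi * lam))) (ℓ : Fin 3 → ℤ) {F : VF} (hF : MemLp F 2 volume)
    (hsupp : ∀ k' : Fin 3 → ℤ, (¬ ∃ z : Fin 3 → ℤ, k' = ℓ + (n : ℤ) • z) → (¬ ∃ z : Fin 3 → ℤ, k' = -ℓ + (n : ℤ) • z) →
      mFourierCoeff (FunctionSpaces.EuclideanSpace.complexify ∘ F) k' = 0)
    {T : ℝ} {u : ℝ → VF}
    (hu : Torus.IsWeakTensorPassiveVectorOn 0 T ((1 / (n:ℝ) ^ 2) • 𝔸) (cellField W M hM ν hν n) F u)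
    (Ks : Fin 3 → ℤ) {lo' dmin : ℝ} (hlo' : 0 ≤ lo') (hdmin : dmin ≤ 2 * Real.pi ^ 2 * lo' * (n : ℝ) ^ 2)
    (hℓn : 2 * ‖Torus.latticeVec ℓ‖ ≤ n) :
    ∀ᵐ t ∂(volume.restrict (Ioo 0 T)), ∀ k : Fin 3 → ℤ,
      (∀ j ∈ ({-2, -1, 0, 1, 2} : Finset ℤ), k ≠ ℓ + j • Ks ∧ k ≠ -(ℓ + j • Ks)) →
      mFourierCoeff (EuclideanSpace.complexify ∘ u t) k ≠ 0 → dmin ≤ 8 * Real.pi ^ 2 * lo' * freqNormSq k := by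
  have hℓn' : ‖Torus.latticeVec ℓ‖ ≤ n := by linarith [norm_nonneg (Torus.latticeVec ℓ)]
  have hdmin' : dmin ≤ 8 * Real.pi ^ 2 * lo' * ((n : ℝ) - ‖Torus.latticeVec ℓ‖) ^ 2 := by
    have h4 : (n : ℝ) ^ 2 ≤ 4 * ((n : ℝ) - ‖Torus.latticeVec ℓ‖) ^ 2 := by nlinarith [norm_nonneg (Torus.latticeVec ℓ)]
    have : 2 * Real.pi ^ 2 * lo' * (n : ℝ) ^ 2 ≤ 8 * Real.pi ^ 2 * lo' * ((n : ℝ) - ‖Torus.latticeVec ℓ‖) ^ 2 := by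
      have hc : 0 ≤ 2 * Real.pi ^ 2 * lo' := by positivity
      nlinarith
    exact hdmin.trans this
  exact ae_gap_of_classPair W M hM hlo hlam hν hn hA ℓ hF hsupp hu Ks hlo' hdmin' hℓn'

end Summit.AnomalousDissipation.AnomalousDissipation.Theorems.SolenoidalFractalHomogenisation.LagrangianStep.CellChain

end
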